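import Summits.BirchSwinnertonDyer.BirchSwinnertonDyer.Theorems.GoldfeldAllTwistsTwoConverseTwinGenusDescentTamagawa
import Summits.BirchSwinnertonDyer.BirchSwinnertonDyer.Theorems.GoldfeldAllTwistsTwoConverseTwinGenusDescentTamagawaLeaf
import Literature.NumberTheory.EllipticCurves.NeronComponentIndexTypeIVExact
import Literature.NumberTheory.EllipticCurves.DegreeConjectureAbcPrelims
import HarnessLib

set_option linter.dupNamespace false -- `…BirchSwinnertonDyer.BirchSwinnertonDyer…` is the cell's namespace (D-0017)
set_option autoImplicit false

/-!
# LINE B49 — the FIXED partner curves, X: `c₂(W₇₈₄) = 4` EXACTLY, `Tam(W₇₈₄) = 8`, and the discharge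
# of the Tamagawa leaf `X049Partner784TamagawaEight` (W-A5 with NO Tamagawa input left)

Cell `bsd-goldfeld`, seat `bsd-goldfeld-s1p-c301` (prover, gen 6); TARGET v5.5 §2 c301 (g) W-A5; support for
item `stmt-BirchSwinnertonDyer-19140`. HONEST FRAMING: kernel theorems about the explicit global minimal model
`W₇₈₄ = [0, −21, 0, 112, 0]` of `49a1^{(−1)}`; nothing about BSD; not in the Theses cone.

WHAT IS PROVED. Files VIII/IX left exactly one bit open: the tree's Step-7 fact for type `Iₙ*` records
only `c₂ ∈ {2, 4}`, so `Tam(W₇₈₄) ∈ {4, 8}` and the printed value `8` was the NAMED INPUT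
`X049Partner784TamagawaEight` (file VII). Here that bit is computed IN THE KERNEL, by rational points:
on the `2`-adically normalised minimal model `J = (1, 0, −1, 0) • W₇₈₄ = [−2, −22, 0, 112, 0]` (the
`I₄*` normal form: `a₁ ∈ 𝔪`, `2 ∥ a₂`, `a₃ ∈ 𝔪²`, `a₄ ∈ 𝔪³`, `a₆ ∈ 𝔪⁴`) the three points
`T = (0, 0)`, `g = (8, 16)` (the image of `g₇₈₄ = (8, 8)`) and `g + T = (14, 0)` all have both
coordinates in `𝔪 = 2ℤ₂`, hence reduce to the singular point `(0, 0)` and lie OUTSIDE `J₀(ℚ₂)`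
(`LocalIndex.not_hasNonsingularReduction_some`). If the index `[J(ℚ₂) : J₀(ℚ₂)]` were `2`, the
non-trivial coset would contain `T`, `g` and `g + T`, forcing it to contain `0` — absurd; with
`LocalIndex.index_mem_of_normalForm_Istar_succ` (`∈ {2, 4}`) the index is `4`, and by
`LocalIndex.localTamagawaNumber_eq_index_of_smul_eq_baseChange` (any minimal `ℤ₂`-model computes the local
Tamagawa number; minimality of `J` at `2` is file III's Kraus test, transported by `isMinimalAt_translate`
and `isMinimalAt_iff_isMinimal_padic`) **`c₂(W₇₈₄) = 4`** (`localTamagawaNumber_padic_W784_two`). With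
file IX's assembly (`tamagawaProduct_eq_prod` over the places `2, 7` of `ℤ`, `c₇ = 2`):
**`tamagawaProduct_W784 : Tam(W₇₈₄) = 8`**, i.e. **`x049Partner784TamagawaEight_holds`** — the leaf of
file VII is DISCHARGED, and W-A5 «BSD₂(784) exact by name» now holds granted only bsd.S31 and Modularity
(`leadingLCoeff_W784`). References: [Silverman1994] IV.9.4 Step 7 and Table 4.1 (component group
`(ℤ/2)²` or `ℤ/4` for `Iₙ*`; here `ℤ/2 × ℤ/2`, classes `0, T, g, g + T`); [SilvermanAEC2009] VII.1.3(b),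
VII.2.1, VII.6; [CremonaAlgorithms1997] Table 1 (N = 784: `c₂ = 4`, `c₇ = 2`).
-/

noncomputable section

open scoped Classical NumberField

open WeierstrassCurve IsDedekindDomain IsLocalRing Rat.HeightOneSpectrum
  Literature.NumberTheory.EllipticCurves Literature.NumberTheory.EllipticCurves.ModularForms
  Summit.BirchSwinnertonDyer.BirchSwinnertonDyer.Rank2Observatory.Tate
  Summit.BirchSwinnertonDyer.BirchSwinnertonDyer.Rank2Observatory.RootNumber

namespace Summit.BirchSwinnertonDyer.BirchSwinnertonDyer.Theorems.GoldfeldGoodTwists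

/-! ### `2`-adic bookkeeping: `𝔪ᵏ = 2ᵏℤ₂` on integers -/

/-- An integer `a` lies in `𝔪ᵏ ⊆ ℤ₂` iff `2ᵏ ∣ a`. [folklore] -/
theorem intCast_mem_maximalIdeal_pow_padicInt_two_iff (a : ℤ) (k : ℕ) :
    ((a : ℤ_[2])) ∈ maximalIdeal ℤ_[2] ^ k ↔ (2 : ℤ) ^ k ∣ a := by
  rw [PadicInt.maximalIdeal_eq_span_p, Ideal.span_singleton_pow, Ideal.mem_span_singleton]
  exact_mod_cast PadicInt.pow_p_dvd_int_iff k a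

/-- An even natural number lies in `𝔪 = 2ℤ₂`. [folklore] -/
theorem natCast_mem_maximalIdeal_padicInt_two {n : ℕ} (hn : 2 ∣ n) :
    ((n : ℤ_[2])) ∈ maximalIdeal ℤ_[2] := by
  have h := (intCast_mem_maximalIdeal_pow_padicInt_two_iff n 1).mpr
    (by rw [pow_one]; exact_mod_cast hn)
  rw [pow_one] at h
  exact_mod_cast h

/-! ### Three rational points of the `I₄*` normal form `J = [−2, −22, 0, 112, 0]` over `ℚ₂` -/

/-- `T = (0, 0) ∈ J(ℚ₂)`, `J = [−2, −22, 0, 112, 0]` (the rational `2`-torsion point). [folklore] -/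
theorem nonsingular_J784_zero_zero :
    ((⟨-2, -22, 0, 112, 0⟩ : WeierstrassCurve ℤ_[2]).baseChange ℚ_[2]).toAffine.Nonsingular
      (algebraMap ℤ_[2] ℚ_[2] 0) (algebraMap ℤ_[2] ℚ_[2] 0) := by
  rw [Affine.nonsingular_iff', Affine.equation_iff']
  simp only [baseChange, toAffine, map_a₁, map_a₂, map_a₃, map_a₄, map_a₆, map_neg, map_ofNat, map_zero]
  norm_num

/-- `g = (8, 16) ∈ J(ℚ₂)` (the image of `g₇₈₄ = (8, 8) ∈ W₇₈₄(ℚ)` under `(x, y) ↦ (x, y + x)`).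
[folklore] -/
theorem nonsingular_J784_eight_sixteen :
    ((⟨-2, -22, 0, 112, 0⟩ : WeierstrassCurve ℤ_[2]).baseChange ℚ_[2]).toAffine.Nonsingular
      (algebraMap ℤ_[2] ℚ_[2] 8) (algebraMap ℤ_[2] ℚ_[2] 16) := by
  rw [Affine.nonsingular_iff', Affine.equation_iff']
  simp only [baseChange, toAffine, map_a₁, map_a₂, map_a₃, map_a₄, map_a₆, map_neg, map_ofNat, map_zero]
  norm_num

/-- `g + T = (14, 0) ∈ J(ℚ₂)`. [folklore] -/
theorem nonsingular_J784_fourteen_zero :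
    ((⟨-2, -22, 0, 112, 0⟩ : WeierstrassCurve ℤ_[2]).baseChange ℚ_[2]).toAffine.Nonsingular
      (algebraMap ℤ_[2] ℚ_[2] 14) (algebraMap ℤ_[2] ℚ_[2] 0) := by
  rw [Affine.nonsingular_iff', Affine.equation_iff']
  simp only [baseChange, toAffine, map_a₁, map_a₂, map_a₃, map_a₄, map_a₆, map_neg, map_ofNat, map_zero]
  norm_num

/-- **`g + T = (14, 0)` in `J(ℚ₂)`** (slope `2`). [folklore] -/
theorem eightSixteen_add_zeroZero_J784 :
    (Affine.Point.some _ _ nonsingular_J784_eight_sixteen :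
        ((⟨-2, -22, 0, 112, 0⟩ : WeierstrassCurve ℤ_[2]).baseChange ℚ_[2]).toAffine.Point) +
      Affine.Point.some _ _ nonsingular_J784_zero_zero =
      Affine.Point.some _ _ nonsingular_J784_fourteen_zero := by
  have hx : algebraMap ℤ_[2] ℚ_[2] 8 ≠ algebraMap ℤ_[2] ℚ_[2] 0 := by
    rw [map_ofNat, map_zero]; norm_num
  rw [Affine.Point.add_of_X_ne hx]
  refine point_some_congr ?_ ?_
  · rw [Affine.slope_of_X_ne hx]
    simp only [Affine.addX, baseChange, toAffine, map_a₁, map_a₂, map_neg, map_ofNat, map_zero]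
    norm_num
  · rw [Affine.addY, Affine.negAddY, Affine.negY, Affine.slope_of_X_ne hx]
    simp only [Affine.addX, baseChange, toAffine, map_a₁, map_a₂, map_a₃, map_neg, map_ofNat, map_zero]
    norm_num

/-! ### The index `[J(ℚ₂) : J₀(ℚ₂)] = 4` -/

/-- **`[J(ℚ₂) : J₀(ℚ₂)] = 4` for `J = [−2, −22, 0, 112, 0]`** (type `I₄*`: the index is `2` or `4` by
`LocalIndex.index_mem_of_normalForm_Istar_succ`; the points `T = (0,0)`, `g = (8,16)`, `g + T = (14,0)`
reduce to the singular point, so index `2` would put `T`, `g`, `g + T` in the same non-trivial coset).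
[cite: Silverman1994, IV.9.4 Step 7 and Table 4.1] -/
theorem index_nonsingularReductionSubgroup_J784 :
    ((⟨-2, -22, 0, 112, 0⟩ : WeierstrassCurve ℤ_[2]).nonsingularReductionSubgroup
      (integers_valuationRing_valuation ℤ_[2] ℚ_[2])).index = 4 := by
  haveI : HenselianLocalRing ℤ_[2] :=
    { is_henselian := fun f hf a₀ h₁ h₂ =>
        HenselianRing.is_henselian (I := IsLocalRing.maximalIdeal ℤ_[2]) f hf a₀ h₁ (h₂.map _) }
  set H := (⟨-2, -22, 0, 112, 0⟩ : WeierstrassCurve ℤ_[2]).nonsingularReductionSubgroup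
    (integers_valuationRing_valuation ℤ_[2] ℚ_[2]) with hH
  have hΔ : (⟨-2, -22, 0, 112, 0⟩ : WeierstrassCurve ℤ_[2]).Δ ≠ 0 := by
    simp only [WeierstrassCurve.Δ, b₂, b₄, b₆, b₈]; norm_num
  have h1 : (⟨-2, -22, 0, 112, 0⟩ : WeierstrassCurve ℤ_[2]).a₁ ∈ maximalIdeal ℤ_[2] := by
    have h := (intCast_mem_maximalIdeal_pow_padicInt_two_iff (-2) 1).mpr (by norm_num)
    rw [pow_one] at h; simpa using h
  have h2 : (⟨-2, -22, 0, 112, 0⟩ : WeierstrassCurve ℤ_[2]).a₂ ∈ maximalIdeal ℤ_[2] := by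
    have h := (intCast_mem_maximalIdeal_pow_padicInt_two_iff (-22) 1).mpr (by norm_num)
    rw [pow_one] at h; simpa using h
  have h2' : (⟨-2, -22, 0, 112, 0⟩ : WeierstrassCurve ℤ_[2]).a₂ ∉ maximalIdeal ℤ_[2] ^ 2 := by
    have h := (intCast_mem_maximalIdeal_pow_padicInt_two_iff (-22) 2).not.mpr (by norm_num)
    simpa using h
  have h3 : (⟨-2, -22, 0, 112, 0⟩ : WeierstrassCurve ℤ_[2]).a₃ ∈ maximalIdeal ℤ_[2] ^ 2 := by simp
  have h4 : (⟨-2, -22, 0, 112, 0⟩ : WeierstrassCurve ℤ_[2]).a₄ ∈ maximalIdeal ℤ_[2] ^ 3 := by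
    have h := (intCast_mem_maximalIdeal_pow_padicInt_two_iff 112 3).mpr (by norm_num)
    simpa using h
  have h6 : (⟨-2, -22, 0, 112, 0⟩ : WeierstrassCurve ℤ_[2]).a₆ ∈ maximalIdeal ℤ_[2] ^ 4 := by simp
  rcases LocalIndex.index_mem_of_normalForm_Istar_succ (K := ℚ_[2]) _ hΔ h1 h2 h2' h3 h4 h6 with h | h
  swap
  · exact h
  exfalso
  -- the three bad points
  have h3₁ : (⟨-2, -22, 0, 112, 0⟩ : WeierstrassCurve ℤ_[2]).a₃ ∈ maximalIdeal ℤ_[2] := by simp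
  have h4₁ : (⟨-2, -22, 0, 112, 0⟩ : WeierstrassCurve ℤ_[2]).a₄ ∈ maximalIdeal ℤ_[2] := by
    simpa using natCast_mem_maximalIdeal_padicInt_two (n := 112) (by norm_num)
  have h0 : (0 : ℤ_[2]) ∈ maximalIdeal ℤ_[2] := Ideal.zero_mem _
  have h8 : (8 : ℤ_[2]) ∈ maximalIdeal ℤ_[2] := by
    simpa using natCast_mem_maximalIdeal_padicInt_two (n := 8) (by norm_num)
  have h16 : (16 : ℤ_[2]) ∈ maximalIdeal ℤ_[2] := by
    simpa using natCast_mem_maximalIdeal_padicInt_two (n := 16) (by norm_num)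
  have h14 : (14 : ℤ_[2]) ∈ maximalIdeal ℤ_[2] := by
    simpa using natCast_mem_maximalIdeal_padicInt_two (n := 14) (by norm_num)
  have hT : (Affine.Point.some _ _ nonsingular_J784_zero_zero) ∉ H := fun hmem =>
    LocalIndex.not_hasNonsingularReduction_some _ h3₁ h4₁ h0 h0 nonsingular_J784_zero_zero
      ((mem_nonsingularReductionSubgroup_iff _).mp hmem)
  have hg : (Affine.Point.some _ _ nonsingular_J784_eight_sixteen) ∉ H := fun hmem =>
    LocalIndex.not_hasNonsingularReduction_some _ h3₁ h4₁ h8 h16 nonsingular_J784_eight_sixteen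
      ((mem_nonsingularReductionSubgroup_iff _).mp hmem)
  have hgT : (Affine.Point.some _ _ nonsingular_J784_fourteen_zero) ∉ H := fun hmem =>
    LocalIndex.not_hasNonsingularReduction_some _ h3₁ h4₁ h14 h0 nonsingular_J784_fourteen_zero
      ((mem_nonsingularReductionSubgroup_iff _).mp hmem)
  -- index two: one non-trivial coset `· + a`
  obtain ⟨a, ha⟩ := AddSubgroup.index_eq_two_iff.mp h
  have key : ∀ P, P ∉ H → P + a ∈ H := fun P hP => by
    rcases ha P with ⟨h', -⟩ | ⟨h', -⟩
    · exact h'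
    · exact (hP h').elim
  have ha' : a ∈ H := by
    have e : a = (Affine.Point.some _ _ nonsingular_J784_eight_sixteen + a) +
        (Affine.Point.some _ _ nonsingular_J784_zero_zero + a) -
        (Affine.Point.some _ _ nonsingular_J784_fourteen_zero + a) := by
      rw [← eightSixteen_add_zeroZero_J784]; abel
    rw [e]
    exact H.sub_mem (H.add_mem (key _ hg) (key _ hT)) (key _ hgT)
  rcases ha 0 with ⟨-, h'⟩ | ⟨-, h'⟩
  · exact h' H.zero_mem
  · exact h' (by rwa [zero_add])

/-! ### `c₂(W₇₈₄) = 4`, `Tam(W₇₈₄) = 8`, the leaf discharged -/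

/-- The translate `(1, 0, −1, 0) • (W₇₈₄ ⊗ ℚ₂) = J ⊗ ℚ₂`, `J = [−2, −22, 0, 112, 0]`. [folklore] -/
theorem smul_W784_padic_two :
    (⟨1, 0, -1, 0⟩ : VariableChange ℚ_[2]) • ((⟨0, -21, 0, 112, 0⟩ : WeierstrassCurve ℚ).baseChange ℚ_[2]) =
      (⟨-2, -22, 0, 112, 0⟩ : WeierstrassCurve ℤ_[2]).baseChange ℚ_[2] := by
  ext <;> simp only [baseChange, map_a₁, map_a₂, map_a₃, map_a₄, map_a₆, variableChange_a₁,
    variableChange_a₂, variableChange_a₃, variableChange_a₄, variableChange_a₆, map_neg, map_ofNat, map_zero,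
    inv_one, Units.val_one] <;> norm_num

/-- `J ⊗ ℚ₂` is a MINIMAL equation over `ℤ₂` (file III's Kraus test at `2` for `W₇₈₄`, transported along
the integral translation and to Mathlib's `ℚ₂`). [cite: Kraus1989, Thm 2 (p = 2)] -/
theorem isMinimal_J784_padic_two :
    ((⟨-2, -22, 0, 112, 0⟩ : WeierstrassCurve ℤ_[2]).baseChange ℚ_[2]).IsMinimal ℤ_[2] := by
  set w₂ : HeightOneSpectrum (𝓞 ℚ) := (primesEquiv (R := 𝓞 ℚ)).symm ⟨2, Nat.prime_two⟩ with hw₂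
  have h2 : ((primesEquiv w₂ : Nat.Primes) : ℕ) = 2 := by rw [hw₂, Equiv.apply_symm_apply]
  have hmin₀ : ((⟨0, -21, 0, 112, 0⟩ : WeierstrassCurve ℤ).baseChange ℚ).IsMinimalAt w₂ := by
    rw [← twoTorsionModel_neg_one_eq_baseChange]
    exact isGloballyMinimal_twoTorsionModel_neg_one.isMinimal w₂
  have hmin := isMinimalAt_translate (v := w₂) (⟨1, 0, -1, 0⟩ : VariableChange ℤ) rfl model_W784_two hmin₀
  have hmin2 := (isMinimalAt_iff_isMinimal_padic w₂ 2 h2 _).mp hmin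
  have e : ((⟨-2, -22, 0, 112, 0⟩ : WeierstrassCurve ℤ).baseChange ℚ).baseChange ℚ_[2] =
      (⟨-2, -22, 0, 112, 0⟩ : WeierstrassCurve ℤ_[2]).baseChange ℚ_[2] := by
    ext <;> simp only [baseChange, map_a₁, map_a₂, map_a₃, map_a₄, map_a₆, map_neg, map_ofNat, map_zero]
  rw [← e]
  exact hmin2

/-- **`c₂(W₇₈₄) = 4`** (Mathlib's `2`-adic numbers): the local Tamagawa number of `W₇₈₄ ⊗ ℚ₂` is the
index `[J(ℚ₂) : J₀(ℚ₂)] = 4` of its minimal `ℤ₂`-model `J`. [cite: Silverman1994, IV.9.4 Step 7 and Table 4.1]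
[cite: CremonaAlgorithms1997, Table 1 (N = 784)] -/
theorem localTamagawaNumber_padic_W784_two :
    (haveI := isElliptic_twoTorsionModel_neg_one
     ((⟨0, -21, 0, 112, 0⟩ : WeierstrassCurve ℚ).baseChange ℚ_[2]).localTamagawaNumber ℤ_[2]) = 4 := by
  haveI := isElliptic_twoTorsionModel_neg_one
  haveI := isMinimal_J784_padic_two
  rw [LocalIndex.localTamagawaNumber_eq_index_of_smul_eq_baseChange _ _ _ smul_W784_padic_two]
  exact index_nonsingularReductionSubgroup_J784

/-- **`c₂(W₇₈₄) = 4` at the place of `𝓞 ℚ` above `2`** (the adèlic local number of `tamagawaProduct`,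
bridged by `localTamagawaNumber_padic_eq_holds`). [cite: Silverman1994, IV.9.4 Step 7 and Table 4.1] -/
theorem localTamagawaNumber_W784_two_eq_four (w : HeightOneSpectrum (𝓞 ℚ)) (hw : natGenerator w = 2) :
    (haveI := isElliptic_twoTorsionModel_neg_one
     ((⟨0, -21, 0, 112, 0⟩ : WeierstrassCurve ℚ).baseChange (w.adicCompletion ℚ)).localTamagawaNumber
        (w.adicCompletionIntegers ℚ)) = 4 := by
  haveI := isElliptic_twoTorsionModel_neg_one
  rw [← localTamagawaNumber_padic_eq_holds (⟨0, -21, 0, 112, 0⟩ : WeierstrassCurve ℚ) w 2 hw]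
  exact localTamagawaNumber_padic_W784_two

/-- **`Tam(W₇₈₄) = c₂ · c₇ = 4 · 2 = 8` IN THE KERNEL** (bad places `2, 7` of `Δ = −2¹²·7³`; product formula
`tamagawaProduct_eq_prod`; `c₇ = 2` of file VIII, `c₂ = 4` above). [cite: Silverman1994, IV.9.4 and Table 4.1]
[cite: CremonaAlgorithms1997, Table 1 (N = 784)] -/
theorem tamagawaProduct_W784 : (⟨0, -21, 0, 112, 0⟩ : WeierstrassCurve ℚ).tamagawaProduct = 8 := by
  haveI := isElliptic_twoTorsionModel_neg_one
  set v₂ : HeightOneSpectrum ℤ := (primesEquiv (R := ℤ)).symm ⟨2, Nat.prime_two⟩ with hv₂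
  set v₇ : HeightOneSpectrum ℤ := (primesEquiv (R := ℤ)).symm ⟨7, by norm_num⟩ with hv₇
  have h2 : (primesEquiv v₂ : ℕ) = 2 := by rw [hv₂, Equiv.apply_symm_apply]
  have h7 : (primesEquiv v₇ : ℕ) = 7 := by rw [hv₇, Equiv.apply_symm_apply]
  have hne : v₂ ≠ v₇ := by
    intro h; have := congrArg (fun v => (primesEquiv v : ℕ)) h; simp only [h2, h7] at this; omega
  have hprod := tamagawaProduct_eq_prod (⟨0, -21, 0, 112, 0⟩ : WeierstrassCurve ℚ) {v₂, v₇} (by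
    intro v hv
    by_contra hmem
    apply hv
    rw [twoTorsionModel_neg_one_eq_baseChange]
    refine hasGoodReductionAt_of_not_dvd fun hdvd => hmem ?_
    rcases eq_two_or_seven_of_dvd_Δ_W784 (prime_natGenerator v) hdvd with h | h
    · have : v = v₂ := by
        apply (primesEquiv (R := ℤ)).injective
        exact Subtype.ext (by rw [h2]; exact h)
      simp [this]
    · have : v = v₇ := by
        apply (primesEquiv (R := ℤ)).injective
        exact Subtype.ext (by rw [h7]; exact h)
      simp [this])
  rw [Finset.prod_pair hne] at hprod
  haveI : Fact (Nat.Prime 7) := ⟨by norm_num⟩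
  have c7 := localTamagawaNumber_padic_W784_eq v₇ 7 h7 2 (fun w hw => localTamagawaNumber_W784_seven w hw)
  have c2 := localTamagawaNumber_padic_W784_eq v₂ 2 h2 4
    (fun w hw => localTamagawaNumber_W784_two_eq_four w hw)
  rw [hprod, c2, c7]
  norm_num

/-- **The Tamagawa leaf `X049Partner784TamagawaEight` of file VII HOLDS** (kernel evaluation of the printed
value `Tam(W₇₈₄) = 8`; the `@[conjecture]` input of `leadingLCoeff_W784_of_tamagawaLeaf` is discharged).
[cite: CremonaAlgorithms1997, Table 1 (N = 784)] [cite: Silverman1994, IV.9.4 and Table 4.1] -/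
theorem x049Partner784TamagawaEight_holds : X049Partner784TamagawaEight := tamagawaProduct_W784

/-- **«BSD₂(784) EXACT» BY NAME, Tamagawa input discharged** (W-A5 of the genus Theorem A plan): granted
bsd.S31 (`bsdTriple_of_rank_le_one_of_conductor_lt`) and Modularity (`exists_isNewformOf`) ONLY, the leading
Taylor coefficient of `L(W₇₈₄, s)` at `s = 1` is `r · Ω(W₇₈₄) · ĥ(g₇₈₄)` with `r ∈ ℚ`, `v₂(r) = 1`
(`r = 2·#Ш/k²`: rank `1`, `Ш[2] = 0`, `#Ш` odd, `#E(ℚ)_tors = 2`, `Tam = 8`, `ĥ(g₇₈₄) = k²·Reg`, `k` odd,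
`N = 784` — all kernel theorems of files I–X). [cite: CreutzMiller2012, Thm 1.1 and the remark following it] -/
theorem leadingLCoeff_W784 (hS31 : bsdTriple_of_rank_le_one_of_conductor_lt) (hmod : exists_isNewformOf) :
    ∃ r : ℚ, padicValRat 2 r = 1 ∧
      (⟨0, -21, 0, 112, 0⟩ : WeierstrassCurve ℚ).leadingLCoeff =
        ((r : ℝ) * (⟨0, -21, 0, 112, 0⟩ : WeierstrassCurve ℚ).realPeriodRat *
          (Affine.Point.some 8 8 nonsingular_W784_eight_eight :
            (⟨0, -21, 0, 112, 0⟩ : WeierstrassCurve ℚ).toAffine.Point).canonicalHeight : ℝ) :=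
  leadingLCoeff_W784_of_tamagawaLeaf hS31 hmod x049Partner784TamagawaEight_holds

end Summit.BirchSwinnertonDyer.BirchSwinnertonDyer.Theorems.GoldfeldGoodTwists

end
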